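import Summits.BirchSwinnertonDyer.BirchSwinnertonDyer.Theorems.AlignedTransportAtTwoMainConjectureTransportAlignedAtTwoBuzzardKFour
import HarnessLib

/-!
# Crux C1 `MainConjectureTransportAlignedAtTwo` (stmt-BirchSwinnertonDyer-22296), line `birth`, plan «deltapos-galois» step (K4-raw):
# FOUR COSETS AT THE CONDUCTOR LEVEL — `dim Λ_N/𝔪Λ_N ≤ 2` for the RAW eigen-ideal `𝔪 = (2, T_q − a_q(W) : all q)` of a newform of an `S₃`-curve
# with `Δ ∉ ℚ₂²`, no depletion (lead att-p1 g10; `--supports 22296`)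

THEOREMS ONLY (no `def`, no `sorry`, no named fact). CONDITIONAL on the two PRINT Hecke-side facts `heckeSelfDual_torsionBy_J0` (DDT Lemma 1.38) and
`buzzard2000_multiplicityOne_gamma0` (Buzzard 2000 Prop. 2.4), as hypotheses. BSD is not proved by this; C1 is not closed by this.

Context (`Cruxes/MainConjectureTransportAlignedAtTwo/Lines/birth-deltapos-galois-plan.md`). att-p4 g11's `…BuzzardKFour.fourCosets_of_dvd_S3` is the
(K4) statement for the `S`-DEPLETED eigenform at a level `L ⊇ N∏_{ℓ∈S}ℓ²` (`U_ℓ g = 0`, `S ≠ ∅`). The Galois route to the `Δ > 0` residual compares the two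
RAW newforms at their COMMON CONDUCTOR level first (equal-conductor case: `f₁ ≡ f₂ (mod 2)` coefficientwise, both in `J₀(N)[𝔪]`; the carrier
`ModularJacobianGaloisData N ι` sees newform parametrisations of level `N` only) and transfers to the depleted level analytically. This file is the
conductor-level twin: **`fourCosets_newformLevel`** — for `W/ℚ` globally minimal, no rational `2`-torsion abscissa, `Δ_W ∉ ℚ₂²`, newform `f` of ODD
level `N` with good reduction away from `2N`, and every additive `K ⊇ 2Λ ∪ ⋃_q (T_q^∨ − a_q(W))Λ` (`Λ = periodHomology N`, ALL primes `q`, `a_q = W.LFunction q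
∈ {0, ±1}` at `q ∣ N`): `Λ` is covered by FOUR cosets of `K`. Proof = att-p4's, with `g := f` (`T_q f = a_q f` for every prime, `IsNewform0.heckeT_eq_coeff_smul`)
and the eigen-ideal `𝔪₀ = span{2, T_q − a_q}` (proper since it acts on `f`, `a₁(f) = 1`, by even integers; `|𝕋/𝔪₀| = 2`; Buzzard via
`…BuzzardGalois.finrank_torsionBySet_eq_two_of_buzzard_S3`; bsd-wall's `exists_fourCosets_periodHomology_of_multiplicityOne`). Also the index form
**`index_le_four_newformLevel`** (`…BuzzardKFour.index_addSubgroupOf_le_four`).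

References: Buzzard, MRL 7 (2000) Prop. 2.4 [Buzzard2000LevelLoweringModTwo]; Darmon–Diamond–Taylor 1995 §1.6 Lemma 1.38, §4.5 [DarmonDiamondTaylor1995].
-/

noncomputable section

-- justification: the `Summit.BirchSwinnertonDyer.BirchSwinnertonDyer.…` path repeats a component (route-file convention)
set_option linter.dupNamespace false
set_option autoImplicit false

open scoped MatrixGroups ComplexConjugate ModularForm NumberField Pointwise Classical
open CongruenceSubgroup Complex WeierstrassCurve IsDedekindDomain Polynomial Field Matrix Literature.NumberTheory.GaloisRepresentations
open Literature.NumberTheory.EllipticCurves Literature.NumberTheory.EllipticCurves.ModularForms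
open Literature.NumberTheory.EllipticCurves.Greenberg1999
open Literature.NumberTheory.EllipticCurves.Rank1Residual Rat.HeightOneSpectrum
open Summit.BirchSwinnertonDyer.BirchSwinnertonDyer.Theorems.ThetaLayerLambdaCongruenceAtTwo
open Summit.BirchSwinnertonDyer.BirchSwinnertonDyer.Theorems.AlignedTransportAtTwoBuzzardGalois
open Summit.BirchSwinnertonDyer.BirchSwinnertonDyer.Theorems.AlignedTransportAtTwoBuzzardKTwo
open Summit.BirchSwinnertonDyer.BirchSwinnertonDyer.Theorems.AlignedTransportAtTwoBuzzardKFour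

namespace Summit.BirchSwinnertonDyer.BirchSwinnertonDyer.Theorems.AlignedTransportAtTwoDeltaPosFourCosets

/-- **(K4) FOUR COSETS AT THE CONDUCTOR LEVEL, raw eigen-ideal, no sign condition.** `W/ℚ` globally minimal without rational `2`-torsion abscissa,
`∀ s : ℚ_[2], s² ≠ Δ_W`; newform `f` of odd level `N` with good reduction at every `p ∤ 2N`; hypotheses `hSD`, `hBz` (PRINT). Then for every additive
`K ⊇ 2Λ, (T_q^∨ − a_q(W))Λ` (`Λ = periodHomology N`, all primes `q`) there are `v₁, v₂ ∈ Λ` with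
`∀ x ∈ Λ, x ∈ K ∨ x − v₁ ∈ K ∨ x − v₂ ∈ K ∨ x − (v₁ + v₂) ∈ K`. [cite: Buzzard2000LevelLoweringModTwo, Prop. 2.4]
[cite: DarmonDiamondTaylor1995, §1.6 Lemma 1.38 and §4.5 Thm. 4.26] -/
theorem fourCosets_newformLevel
    (hSD : heckeSelfDual_torsionBy_J0) (hBz : buzzard2000_multiplicityOne_gamma0)
    (W : WeierstrassCurve ℚ) [W.IsElliptic] [W.IsGloballyMinimal] (ht : ∀ x : ℚ, ¬ HasRationalTwoTorsionX W x)
    (hΔ₂ : ∀ s : ℚ_[2], s ^ 2 ≠ (W.Δ : ℚ_[2]))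
    {N : ℕ} [NeZero N] {f : CuspForm (Gamma0 N) 2} (hf : IsNewformOf W f) (hN : Odd N)
    (hgood : ∀ v : HeightOneSpectrum (𝓞 ℚ), ¬ ((primesEquiv v : ℕ) ∣ 2 * N) → W.HasGoodReductionAt v)
    (K : AddSubgroup (Module.Dual ℂ (CuspForm (Gamma0 N) 2)))
    (h2K : ∀ x ∈ periodHomology N, (2 : ℂ) • x ∈ K)
    (hTK : ∀ (q : ℕ) (hq : q.Prime), ∀ x ∈ periodHomology N,
      (haveI : NeZero q := ⟨hq.ne_zero⟩; heckeT (Gamma0 N) 2 q).dualMap x - (W.LFunction q : ℂ) • x ∈ K) :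
    ∃ v₁ ∈ periodHomology N, ∃ v₂ ∈ periodHomology N, ∀ x ∈ periodHomology N,
      x ∈ K ∨ x - v₁ ∈ K ∨ x - v₂ ∈ K ∨ x - (v₁ + v₂) ∈ K := by
  classical
  set G : Set (HeckeRing0 N 2) := {t : HeckeRing0 N 2 | t = 2 ∨ ∃ (q : ℕ) (hq : q.Prime),
      t = HeckeRing0.T N 2 q hq - ((W.LFunction q : ℤ) : HeckeRing0 N 2)} with hGdef
  -- `T_q f = a_q f` for every prime, `a₁(f) = 1`
  have hb : ∀ (q : ℕ) (hq : q.Prime), (haveI : NeZero q := ⟨hq.ne_zero⟩; heckeT (Gamma0 N) 2 q f) =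
      (((W.LFunction q : ℤ)) : ℂ) • f := fun q hq ↦ by
    haveI : NeZero q := ⟨hq.ne_zero⟩
    have h1 := hf.1.heckeT_eq_coeff_smul hq
    have h2 : cuspCoeff f q = (W.LFunction q : ℂ) := hf.2 q
    rw [cuspCoeff] at h2
    rw [h1, h2]
  have hf1 : cuspCoeff f 1 = 1 := (isNormalized_iff_cuspCoeff_one f).mp hf.1.2.2
  -- the eigen-ideal acts on `f` by even integers and contains `2`
  have h2 : (2 : HeckeRing0 N 2) ∈ Ideal.span G := Ideal.subset_span (Or.inl rfl)
  have h𝔪 : ∀ t ∈ Ideal.span G, ∃ e : ℤ, HeckeRing0.toEnd N 2 t f = ((2 * e : ℤ) : ℂ) • f :=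
    ideal_span_acts_even f (fun q ↦ W.LFunction q) hb G fun t ht ↦ by
      rcases ht with rfl | ⟨q, hq, rfl⟩
      · exact Or.inl rfl
      · exact Or.inr ⟨q, hq, rfl⟩
  -- `𝔪₀ ≠ ⊤`: `1` acts on `f ≠ 0` by `1`, not by an even integer
  have hne : Ideal.span G ≠ ⊤ := by
    intro htop
    obtain ⟨e, he⟩ := h𝔪 1 (htop ▸ Submodule.mem_top)
    rw [map_one, Module.End.one_apply] at he
    have h1 : cuspCoeff f 1 = ((2 * e : ℤ) : ℂ) * cuspCoeff f 1 := by
      have hsm := (cuspCoeffₗ (one_mem_strictPeriods_coe_gamma0 N) 1).map_smul ((2 * e : ℤ) : ℂ) f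
      rw [cuspCoeffₗ_apply, cuspCoeffₗ_apply, smul_eq_mul, ← he] at hsm
      exact hsm
    rw [hf1, mul_one] at h1
    have h2e : (1 : ℤ) = 2 * e := by exact_mod_cast h1
    omega
  have hT' : ∀ (p : ℕ) (hp : p.Prime), ∃ n : ℤ, HeckeRing0.T N 2 p hp - (n : HeckeRing0 N 2) ∈ Ideal.span G :=
    fun p hp ↦ ⟨W.LFunction p, Ideal.subset_span (Or.inr ⟨p, hp, rfl⟩)⟩
  have hq := natCard_quotient_eq_two_of_ne_top (Ideal.span G) h2 hT' hne
  haveI h𝔪max : (Ideal.span G).IsMaximal := isMaximal_of_natCard_quotient_eq_two _ hq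
  have hT : ∀ (q : ℕ) (hq' : q.Prime), ¬ q ∣ N →
      HeckeRing0.T N 2 q hq' - (W.LFunction q : HeckeRing0 N 2) ∈ Ideal.span G :=
    fun q hq' _ ↦ Ideal.subset_span (Or.inr ⟨q, hq', rfl⟩)
  have hsub := finrank_torsionBySet_eq_two_of_buzzard_S3 hBz W ht hΔ₂ N hN hgood (Ideal.span G) h𝔪max h2 hq hT
  -- B4 from `hsub` and the self-duality pairing
  obtain ⟨B, hbal, hleft, -⟩ := hSD N 2
  obtain ⟨v₁, hv₁, v₂, hv₂, hcos⟩ := exists_fourCosets_periodHomology_of_multiplicityOne _ h2 hq hsub B hbal hleft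
  -- `𝔪₀Λ ⊆ K`
  have hK𝔪 : ∀ z ∈ Ideal.span G • periodHomologyHecke N, z ∈ K := by
    refine mem_of_mem_ideal_span_smul G K fun s hs z hz ↦ ?_
    rcases hs with rfl | ⟨q, hq', rfl⟩
    · have : (2 : HeckeRing0 N 2) • z = (2 : ℂ) • z := by
        rw [show (2 : HeckeRing0 N 2) = ((2 : ℤ) : HeckeRing0 N 2) by norm_num, heckeRing0_intCast_smul, Int.cast_ofNat]
      rw [this]
      exact h2K z hz
    · rw [sub_smul, heckeRing0_T_smul, heckeRing0_intCast_smul]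
      exact hTK q hq' z hz
  refine ⟨v₁, hv₁, v₂, hv₂, fun x hx ↦ ?_⟩
  rcases hcos x hx with h | h | h | h
  · exact Or.inl (hK𝔪 _ h)
  · exact Or.inr (Or.inl (hK𝔪 _ h))
  · exact Or.inr (Or.inr (Or.inl (hK𝔪 _ h)))
  · exact Or.inr (Or.inr (Or.inr (hK𝔪 _ h)))

/-- **Index form**: under the hypotheses of `fourCosets_newformLevel`, `K ∩ Λ` has index `≠ 0` and `≤ 4` in `Λ = periodHomology N` — the input `hK0`, `hK4` of
`…DeltaPosGaloisPlane.exists_equivariant_addEquiv_comp_eq`. [cite: Buzzard2000LevelLoweringModTwo, Prop. 2.4] -/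
theorem index_le_four_newformLevel
    (hSD : heckeSelfDual_torsionBy_J0) (hBz : buzzard2000_multiplicityOne_gamma0)
    (W : WeierstrassCurve ℚ) [W.IsElliptic] [W.IsGloballyMinimal] (ht : ∀ x : ℚ, ¬ HasRationalTwoTorsionX W x)
    (hΔ₂ : ∀ s : ℚ_[2], s ^ 2 ≠ (W.Δ : ℚ_[2]))
    {N : ℕ} [NeZero N] {f : CuspForm (Gamma0 N) 2} (hf : IsNewformOf W f) (hN : Odd N)
    (hgood : ∀ v : HeightOneSpectrum (𝓞 ℚ), ¬ ((primesEquiv v : ℕ) ∣ 2 * N) → W.HasGoodReductionAt v)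
    (K : AddSubgroup (Module.Dual ℂ (CuspForm (Gamma0 N) 2)))
    (h2K : ∀ x ∈ periodHomology N, (2 : ℂ) • x ∈ K)
    (hTK : ∀ (q : ℕ) (hq : q.Prime), ∀ x ∈ periodHomology N,
      (haveI : NeZero q := ⟨hq.ne_zero⟩; heckeT (Gamma0 N) 2 q).dualMap x - (W.LFunction q : ℂ) • x ∈ K) :
    (K.addSubgroupOf (periodHomology N)).index ≠ 0 ∧ (K.addSubgroupOf (periodHomology N)).index ≤ 4 := by
  obtain ⟨v₁, hv₁, v₂, hv₂, hcos⟩ := fourCosets_newformLevel hSD hBz W ht hΔ₂ hf hN hgood K h2K hTK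
  exact index_addSubgroupOf_le_four (periodHomology N) K hv₁ hv₂ hcos

end Summit.BirchSwinnertonDyer.BirchSwinnertonDyer.Theorems.AlignedTransportAtTwoDeltaPosFourCosets

end
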